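import Literature.Combinatorics.Additive.TripleProductProperty
import Summits.MatrixMultiplication.MatrixMultiplication.Theorems.SnSubsetDichotomyThresholdSubsetTriplesPairFactorisation

/-!
# `SnSubsetDichotomy.ThresholdSubsetTriples`, line `interleaved-subsignature-ascent` — an exact owner pair excludes a further class in every slot

Crux `stmt-MatrixMultiplication-10882` (`ThresholdSubsetTriples`), negative design rule of census c3a, completed to
all three positions.  The owner chain classes `S_A = subsig (ownerSystem L)` and `S_B = subsig (ownerSystem Lᶜ)` of
complementary level sets factorise `S_n` exactly (`stub_pairFactorisation`, landed: `S_A⁻¹ S_B = S_n` with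
uniqueness).  The landed stub `stub_ownerPairNoThird` (`SnSubsetDichotomyThresholdSubsetTriplesStubOwnerPairNoThird.lean`,
p113050) records the consequence for the THIRD slot: `(S_A, S_B, U)` TPP ⇒ `|U| ≤ 1`.  This file adds, from the
same single factorisation:

* `ownerPair_absorbs` — every permutation is a mixed pair quotient `a₀ a⁻¹ · (b b₀⁻¹)` (`a₀, a ∈ S_A`,
  `b, b₀ ∈ S_B`);
* `ownerPairNoFirst` — `(U, S_A, S_B)` TPP ⇒ `|U| ≤ 1` (the third-slot relation cycled);
* `stub_ownerPairNoMiddle` (registered stub) — `(S_A, U, S_B)` TPP ⇒ `|U| ≤ 1` (factorise `a₀⁻¹ (u u'⁻¹) b₀ = a⁻¹ b` and read it as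
  `a a₀⁻¹ · (u u'⁻¹) · (b₀ b⁻¹) = 1`).

So the design rule reads: next to an exact owner pair, in ANY position, a further class is trivial — the third
class of a TPP chain triple lives in the pair's slack.  (The third-slot statement itself is not repeated here; import
the canonical file for it.)  Mathlib + the landed vocabulary / factorisation files only.
-/

-- `Summit.<Summit>.<Problem>` is the tree's mandated summit-side namespace; for this single-conjunct summit the
-- two components coincide, so the file silences `dupNamespace` (same as the vocabulary file it imports).
set_option linter.dupNamespace false
set_option autoImplicit false

namespace Summit.MatrixMultiplication.MatrixMultiplication.Theorems.ThresholdSubsetTriples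

open Literature.Combinatorics.Additive

/-- Absorption by the exact owner pair: every permutation `σ` is a mixed pair quotient `a₀ a⁻¹ · (b b₀⁻¹)` with
`a₀, a ∈ S_A = subsig (ownerSystem L)` and `b, b₀ ∈ S_B = subsig (ownerSystem Lᶜ)` — take any pair `(a₀, b₀)`
(factorise `1`) and factorise `a₀⁻¹ σ b₀ = a⁻¹ b` by `stub_pairFactorisation`. -/
theorem ownerPair_absorbs {n : ℕ} (L : Finset (Fin n)) (σ : Equiv.Perm (Fin n)) :
    ∃ a₀ ∈ subsig (ownerSystem L), ∃ a ∈ subsig (ownerSystem L),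
      ∃ b ∈ subsig (ownerSystem Lᶜ), ∃ b₀ ∈ subsig (ownerSystem Lᶜ), a₀ * a⁻¹ * (b * b₀⁻¹) = σ := by
  obtain ⟨⟨a₀, b₀⟩, ⟨ha₀, hb₀, -⟩, -⟩ := stub_pairFactorisation L 1
  obtain ⟨⟨a, b⟩, ⟨ha, hb, hab⟩, -⟩ := stub_pairFactorisation L (a₀⁻¹ * σ * b₀)
  refine ⟨a₀, ha₀, a, ha, b, hb, b₀, hb₀, ?_⟩
  calc a₀ * a⁻¹ * (b * b₀⁻¹) = a₀ * (a⁻¹ * b) * b₀⁻¹ := by group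
    _ = σ := by rw [hab]; group

/-- **First-slot exclusion.**  The exact owner pair admits no FIRST class with two elements: if
`(U, subsig (ownerSystem L), subsig (ownerSystem Lᶜ))` has the triple product property then `|U| ≤ 1`
(the pair absorbs `u' u⁻¹`, `ownerPair_absorbs`, and `u u'⁻¹ · (a₀ a⁻¹) · (b b₀⁻¹) = 1` is the third-slot
relation cycled). -/
theorem ownerPairNoFirst {n : ℕ} (L : Finset (Fin n)) (U : Finset (Equiv.Perm (Fin n)))
    (hT : TripleProductProperty U (subsig (ownerSystem L)) (subsig (ownerSystem Lᶜ))) : U.card ≤ 1 := by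
  rw [Finset.card_le_one]
  intro u hu u' hu'
  obtain ⟨a₀, ha₀, a, ha, b, hb, b₀, hb₀, hab⟩ := ownerPair_absorbs L (u' * u⁻¹)
  have key : u * u'⁻¹ * (a₀ * a⁻¹) * (b * b₀⁻¹) = 1 := by
    rw [mul_assoc (u * u'⁻¹), hab]; group
  exact (hT u hu u' hu' a₀ ha₀ a ha b hb b₀ hb₀ key).1

/-- **Middle-slot exclusion (stub `stub_ownerPairNoMiddle`).**  The exact owner pair admits no MIDDLE class
with two elements: if
`(subsig (ownerSystem L), U, subsig (ownerSystem Lᶜ))` has the triple product property then `|U| ≤ 1` —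
factorise `a₀⁻¹ (u u'⁻¹) b₀ = a⁻¹ b` (`stub_pairFactorisation`) and read it as the relation
`a a₀⁻¹ · (u u'⁻¹) · (b₀ b⁻¹) = 1`. -/
theorem stub_ownerPairNoMiddle {n : ℕ} (L : Finset (Fin n)) (U : Finset (Equiv.Perm (Fin n)))
    (hT : TripleProductProperty (subsig (ownerSystem L)) U (subsig (ownerSystem Lᶜ))) : U.card ≤ 1 := by
  rw [Finset.card_le_one]
  intro u hu u' hu'
  obtain ⟨⟨a₀, b₀⟩, ⟨ha₀, hb₀, -⟩, -⟩ := stub_pairFactorisation L 1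
  obtain ⟨⟨a, b⟩, ⟨ha, hb, hab⟩, -⟩ := stub_pairFactorisation L (a₀⁻¹ * (u * u'⁻¹) * b₀)
  have key : a * a₀⁻¹ * (u * u'⁻¹) * (b₀ * b⁻¹) = 1 := by
    calc a * a₀⁻¹ * (u * u'⁻¹) * (b₀ * b⁻¹) = a * (a₀⁻¹ * (u * u'⁻¹) * b₀) * b⁻¹ := by group
      _ = 1 := by rw [← hab]; group
  exact (hT a ha a₀ ha₀ u hu u' hu' b₀ hb₀ b hb key).2.1

end Summit.MatrixMultiplication.MatrixMultiplication.Theorems.ThresholdSubsetTriples
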